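import Literature.MathematicalPhysics.QuantumLattice.DysonOrderedIntegral
import Literature.MathematicalPhysics.QuantumLattice.HubbardAtomicLimit
import Literature.MathematicalPhysics.QuantumLattice.HubbardHubbardModelEtaODLROProofs
import Literature.MathematicalPhysics.QuantumLattice.HubbardBandBottomModes
import Literature.MathematicalPhysics.QuantumLattice.HubbardBandBottomOneBody
import HarnessLib

/-!
# Sector lower bounds for the repulsive Hubbard Hamiltonian (band bottom, part 3)

Topic `Literature/MathematicalPhysics/QuantumLattice` (sub-namespace `HubbardBandBottom`). Written for
route `HubbardSuperconductivity/ParityLeeYang`, support `BandBottomOnAxis` (stmt-HubbardSuperconductivity-8386).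

For `H = hamiltonian G 1 U = dΓ(h) + U Σ_x n_{x↑}n_{x↓}`, `U ≥ 0`, `h = hubbardOneBody G 1 0` the
spin-diagonal doubling of a Hermitian site matrix `A` whose lowest eigenvalue `E₁` is SIMPLE with
gap `γ`:

* `re_rayleigh_doublon_nonneg`, `re_rayleigh_dGamma_le_hamiltonian` — the interaction is a
  nonnegative form, so `Re ⟨ψ, H ψ⟩ ≥ Re ⟨ψ, dΓ(h) ψ⟩`;
* `sector_lower_bound` — on the `N`-particle sector `Re ⟨ψ, H ψ⟩ ≥ (N E₁ + γ (N - 2)) ‖ψ‖²`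
  (Pauli: only the two spin copies of the bottom mode have energy `E₁`);
* `bottomMode_eigenvector` — the one-particle state `c†(u_{b↑}) |∅⟩` is a unit eigenvector of `H`
  with eigenvalue `E₁`.

Everything is proved; no definitions. Sources: Bratteli–Robinson II §5.2.1 (second quantisation);
Lieb–Wu (2003) §2 (Perron–Frobenius input, see part 2).
-/

namespace Literature.MathematicalPhysics.QuantumLattice.HubbardBandBottom

open Matrix Finset Literature.MathematicalPhysics.QuantumLattice
  Literature.MathematicalPhysics.QuantumLattice.RayleighBound
open scoped ComplexOrder

variable {Λ : Type*} [LinearOrder Λ] [Fintype Λ] (G : SimpleGraph Λ) [DecidableRel G.Adj]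

/-- The on-site repulsion is a nonnegative form: `Re ⟨ψ, Σ_x n_{x↑} n_{x↓} ψ⟩ ≥ 0`
(each `n_{x↑}n_{x↓}` is a diagonal `0/1` matrix). [folklore] -/
theorem re_rayleigh_doublon_nonneg (ψ : Fock (Orb Λ)) :
    0 ≤ (star ψ ⬝ᵥ ((∑ x : Λ, creation (orb x 0) * annihilation (orb x 0) *
      (creation (orb x 1) * annihilation (orb x 1))) *ᵥ ψ)).re := by
  rw [Matrix.sum_mulVec, dotProduct_sum, Complex.re_sum]
  refine Finset.sum_nonneg fun x _ => ?_
  have hD : creation (orb x 0) * annihilation (orb x 0) *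
      (creation (orb x 1) * annihilation (orb x 1)) = numberOp x 0 * numberOp x 1 := rfl
  rw [hD, numberOp_mul_numberOp_eq_diagonal, dotProduct, Complex.re_sum]
  refine Finset.sum_nonneg fun s _ => ?_
  rw [mulVec_diagonal, Pi.star_apply]
  split_ifs
  · rw [one_mul, Complex.star_def, ← Complex.normSq_eq_conj_mul_self]
    exact_mod_cast Complex.normSq_nonneg _
  · simp

/-- For `U ≥ 0` the Hubbard energy form dominates its kinetic part:
`Re ⟨ψ, dΓ(h) ψ⟩ ≤ Re ⟨ψ, H ψ⟩`, `h = hubbardOneBody G 1 0`, `H = hamiltonian G 1 U`. [folklore] -/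
theorem re_rayleigh_dGamma_le_hamiltonian {U : ℝ} (hU : 0 ≤ U) (ψ : Fock (Orb Λ)) :
    (star ψ ⬝ᵥ (dGamma (hubbardOneBody G 1 0) *ᵥ ψ)).re ≤
      (star ψ ⬝ᵥ (hamiltonian G 1 U *ᵥ ψ)).re := by
  rw [← hamiltonianWith_zero, hamiltonianWith_eq_dGamma_add_smul, add_mulVec, dotProduct_add,
    Complex.add_re, smul_mulVec, dotProduct_smul, smul_eq_mul, Complex.re_ofReal_mul]
  have := re_rayleigh_doublon_nonneg ψ
  nlinarith

omit [Fintype Λ] in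
/-- The free one-body matrix at `t = 1`, `μ = 0` is the spin-diagonal doubling of minus the
adjacency matrix: `h_{(x,σ),(y,τ)} = [σ = τ] · (-[x ∼ y])`. [folklore] -/
theorem hubbardOneBody_orb_orb (x : Λ) (σ : Fin 2) (y : Λ) (τ : Fin 2) :
    hubbardOneBody G 1 0 (orb x σ) (orb y τ) =
      if σ = τ then (Matrix.of fun x y : Λ => if G.Adj x y then (-1 : ℂ) else 0) x y else 0 := by
  rw [hubbardOneBody_apply]
  simp only [orb, ofLex_toLex, Complex.ofReal_one, Complex.ofReal_zero, Matrix.of_apply]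
  by_cases h1 : σ = τ <;> by_cases h2 : G.Adj x y <;> simp [h1, h2]

omit [LinearOrder Λ] [Fintype Λ] in
/-- Minus the adjacency matrix is Hermitian (real symmetric). [folklore] -/
theorem isHermitian_negAdj :
    (Matrix.of fun x y : Λ => if G.Adj x y then (-1 : ℂ) else 0).IsHermitian := by
  refine Matrix.IsHermitian.ext fun x y => ?_
  simp only [Matrix.of_apply, G.adj_comm x y]
  split_ifs <;> simp

/-- **Sector lower bound.** Let `A` be a Hermitian site matrix whose spin doubling is
`hubbardOneBody G 1 0`, with a unique bottom index `b` (`λ_k = E₁ ↔ k = b`) and gap `γ ≥ 0` above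
`E₁ = A.groundEnergy`. Then for `U ≥ 0`, on the `N`-particle sector,
`(N E₁ + γ (N - 2)) ‖ψ‖² ≤ Re ⟨ψ, H ψ⟩`. [folklore] -/
theorem sector_lower_bound {A : Matrix Λ Λ ℂ} (hA : A.IsHermitian)
    (hhA : ∀ x σ y τ, hubbardOneBody G 1 0 (orb x σ) (orb y τ) = if σ = τ then A x y else 0)
    {b : Λ} (hb : ∀ k, hA.eigenvalues k = A.groundEnergy → k = b) {γ : ℝ} (hγ0 : 0 ≤ γ)
    (hγ : ∀ k, k ≠ b → A.groundEnergy + γ ≤ hA.eigenvalues k) {U : ℝ} (hU : 0 ≤ U)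
    {N : ℕ} {ψ : Fock (Orb Λ)} (hψ : IsNParticle N ψ) :
    ((N : ℝ) * A.groundEnergy + γ * ((N : ℝ) - 2)) * normSq ψ ≤
      (star ψ ⬝ᵥ (hamiltonian G 1 U *ᵥ ψ)).re := by
  classical
  refine le_trans ?_ (re_rayleigh_dGamma_le_hamiltonian G hU ψ)
  -- the spin-doubled eigenmodes
  set u : Orb Λ → Orb Λ → ℂ := fun κ o => if (ofLex o).2 = (ofLex κ).2 then
      (hA.eigenvectorUnitary : Matrix Λ Λ ℂ) (ofLex o).1 (ofLex κ).1 else 0 with hu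
  have hu' : ∀ κ o, u κ o = if (ofLex o).2 = (ofLex κ).2 then
      (hA.eigenvectorUnitary : Matrix Λ Λ ℂ) (ofLex o).1 (ofLex κ).1 else 0 := fun κ o => rfl
  set S : Finset (Orb Λ) := {orb b 0, orb b 1} with hS
  have hScard : S.card = 2 := by
    rw [hS, Finset.card_pair]
    exact fun h => absurd (orb_eq_orb_iff.1 h).2 (by decide)
  have key := pauli_lower_bound (hubbardOneBody G 1 0) u (fun κ => hA.eigenvalues (ofLex κ).1)
    (spinModes_complete hA u hu') (fun κ => by rw [spinModes_orthonormal hA u hu', if_pos rfl])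
    (spinModes_eigen hA _ hhA u hu') hγ0 S (fun κ => groundEnergy_le_eigenvalues hA _)
    (fun κ hκ => hγ _ fun hkb => hκ ?_) hψ
  · rwa [hScard, Nat.cast_two] at key
  · -- a mode of the bottom site lies in `S`
    rw [hS, Finset.mem_insert, Finset.mem_singleton]
    obtain ⟨⟨k, σ⟩, rfl⟩ : ∃ p : Λ × Fin 2, toLex p = κ := ⟨ofLex κ, toLex_ofLex κ⟩
    simp only [ofLex_toLex] at hkb
    subst hkb
    fin_cases σ
    · exact Or.inl rfl
    · exact Or.inr rfl

/-- `c(f) |∅⟩ = 0`. [folklore] -/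
theorem annihilate_mulVec_vacuum {ι : Type*} [LinearOrder ι] [Fintype ι] (f : ι → ℂ) :
    annihilate f *ᵥ (vacuum : Fock ι) = 0 :=
  EtaPairingODLRO.isNParticle_vacuum.annihilate_mulVec_zero f

/-- `⟨∅|∅⟩ = 1`. [folklore] -/
theorem star_vacuum_dotProduct_vacuum' {ι : Type*} [LinearOrder ι] [Fintype ι] :
    star (vacuum : Fock ι) ⬝ᵥ vacuum = 1 := by
  rw [vacuum, dotProduct, Finset.sum_eq_single (∅ : Finset ι)]
  · simp
  · intro s _ hs
    rw [Pi.single_eq_of_ne hs, mul_zero]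
  · exact fun h => absurd (Finset.mem_univ _) h

/-- The rotated number operator of a unit mode fixes the one-particle state of that mode and kills
those of orthogonal modes: `n(f) c†(g)|∅⟩ = δ c†(g)|∅⟩` where `⟨f, g⟩ = δ ∈ {0, 1}` and `δ = 1`
forces `f = g`. [folklore] -/
theorem numberMode_mulVec_create_vacuum {ι : Type*} [LinearOrder ι] [Fintype ι] {f g : ι → ℂ}
    (p : Prop) [Decidable p] (hfg : star f ⬝ᵥ g = if p then 1 else 0) (hp : p → f = g) :
    numberMode f *ᵥ (create g *ᵥ (vacuum : Fock ι)) =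
      (if p then (1 : ℂ) else 0) • (create g *ᵥ vacuum) := by
  have h := annihilate_mul_create_add f g
  rw [hfg] at h
  have h' : annihilate f * create g = (if p then (1 : ℂ) else 0) • 1 - create g * annihilate f :=
    eq_sub_of_add_eq h
  calc numberMode f *ᵥ (create g *ᵥ vacuum)
      = (create f * (annihilate f * create g)) *ᵥ vacuum := by
        rw [numberMode, mulVec_mulVec, mul_assoc]
    _ = ((if p then (1 : ℂ) else 0) • create f - create f * create g * annihilate f) *ᵥ
          vacuum := by
        rw [h', mul_sub, mul_smul_comm, mul_one, mul_assoc]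
    _ = (if p then (1 : ℂ) else 0) • (create f *ᵥ vacuum) := by
        rw [sub_mulVec, smul_mulVec, ← mulVec_mulVec, annihilate_mulVec_vacuum, mulVec_zero,
          sub_zero]
    _ = _ := by
        by_cases hp' : p
        · rw [if_pos hp', hp hp']
        · rw [if_neg hp', zero_smul, zero_smul]

/-- `c†(f)|∅⟩` is a unit vector for a unit mode `f`. [folklore] -/
theorem star_create_vacuum_dotProduct_self {ι : Type*} [LinearOrder ι] [Fintype ι] {f : ι → ℂ}
    (hf : star f ⬝ᵥ f = 1) :
    star (create f *ᵥ (vacuum : Fock ι)) ⬝ᵥ (create f *ᵥ vacuum) = 1 := by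
  rw [star_mulVec_dotProduct, create_conjTranspose, mulVec_mulVec,
    annihilate_mul_create_of_unit hf, sub_mulVec, one_mulVec, ← mulVec_mulVec,
    annihilate_mulVec_vacuum, mulVec_zero, sub_zero, star_vacuum_dotProduct_vacuum']

/-- The on-site repulsion kills one-particle states. [folklore] -/
theorem doublon_mulVec_eq_zero_of_isNParticle_one {ψ : Fock (Orb Λ)} (hψ : IsNParticle 1 ψ) :
    (∑ x : Λ, creation (orb x 0) * annihilation (orb x 0) *
      (creation (orb x 1) * annihilation (orb x 1))) *ᵥ ψ = 0 := by
  rw [Matrix.sum_mulVec]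
  refine Finset.sum_eq_zero fun x _ => ?_
  have hD : creation (orb x 0) * annihilation (orb x 0) *
      (creation (orb x 1) * annihilation (orb x 1)) = numberOp x 0 * numberOp x 1 := rfl
  rw [hD, numberOp_mul_numberOp_eq_diagonal]
  funext s
  rw [mulVec_diagonal, Pi.zero_apply]
  split_ifs with hs
  · rw [hψ s, mul_zero]
    intro hcard
    obtain ⟨a, ha⟩ := Finset.card_eq_one.1 hcard
    have h0 : orb x 0 = a := Finset.mem_singleton.1 (ha ▸ hs.1)
    have h1 : orb x 1 = a := Finset.mem_singleton.1 (ha ▸ hs.2)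
    exact absurd (orb_eq_orb_iff.1 (h0.trans h1.symm)).2 (by decide)
  · rw [zero_mul]

/-- **The bottom one-particle state is an eigenvector of `H` with eigenvalue `E₁`.** With the data
of `sector_lower_bound` and `b` the bottom index, `v = c†(u_{b↑})|∅⟩` is a unit one-particle
vector with `H v = E₁ v` (the interaction vanishes on one particle). [folklore] -/
theorem bottomMode_eigenvector {A : Matrix Λ Λ ℂ} (hA : A.IsHermitian)
    (hhA : ∀ x σ y τ, hubbardOneBody G 1 0 (orb x σ) (orb y τ) = if σ = τ then A x y else 0)
    {b : Λ} (hb : hA.eigenvalues b = A.groundEnergy) (U : ℝ) (f : Orb Λ → ℂ)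
    (hf : ∀ o, f o = if (ofLex o).2 = 0 then (hA.eigenvectorUnitary : Matrix Λ Λ ℂ) (ofLex o).1 b
      else 0) :
    IsNParticle 1 (create f *ᵥ (vacuum : Fock (Orb Λ))) ∧
      star (create f *ᵥ (vacuum : Fock (Orb Λ))) ⬝ᵥ (create f *ᵥ vacuum) = 1 ∧
      hamiltonian G 1 U *ᵥ (create f *ᵥ vacuum) =
        ((A.groundEnergy : ℝ) : ℂ) • (create f *ᵥ vacuum) := by
  classical
  set u : Orb Λ → Orb Λ → ℂ := fun κ o => if (ofLex o).2 = (ofLex κ).2 then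
      (hA.eigenvectorUnitary : Matrix Λ Λ ℂ) (ofLex o).1 (ofLex κ).1 else 0 with hu
  have hu' : ∀ κ o, u κ o = if (ofLex o).2 = (ofLex κ).2 then
      (hA.eigenvectorUnitary : Matrix Λ Λ ℂ) (ofLex o).1 (ofLex κ).1 else 0 := fun κ o => rfl
  have hfu : f = u (orb b 0) := by
    funext o; rw [hf, hu']; rfl
  have hon := spinModes_orthonormal hA u hu'
  have hunit : star f ⬝ᵥ f = 1 := by rw [hfu, hon, if_pos rfl]
  have h1 : IsNParticle 1 (create f *ᵥ (vacuum : Fock (Orb Λ))) :=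
    EtaPairingODLRO.isNParticle_vacuum.create_mulVec f
  refine ⟨h1, star_create_vacuum_dotProduct_self hunit, ?_⟩
  rw [← hamiltonianWith_zero, hamiltonianWith_eq_dGamma_add_smul, add_mulVec, smul_mulVec,
    doublon_mulVec_eq_zero_of_isNParticle_one h1, smul_zero, add_zero,
    dGamma_eq_sum_smul_numberMode (hubbardOneBody G 1 0) u (fun κ => hA.eigenvalues (ofLex κ).1)
      (spinModes_complete hA u hu') (spinModes_eigen hA _ hhA u hu'),
    Matrix.sum_mulVec, Finset.sum_eq_single (orb b 0)]
  · rw [smul_mulVec, hfu, numberMode_mulVec_create_vacuum (orb b 0 = orb b 0) (hon _ _)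
      (fun _ => rfl), if_pos rfl, one_smul]
    simp [orb, hb]
  · intro κ _ hκ
    rw [smul_mulVec, hfu, numberMode_mulVec_create_vacuum (κ = orb b 0) (hon _ _)
      (fun h => by rw [h]), if_neg hκ, zero_smul, smul_zero]
  · exact fun h => absurd (Finset.mem_univ _) h

end Literature.MathematicalPhysics.QuantumLattice.HubbardBandBottom
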